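import Summits.ResolutionOfSingularities.ResolutionOfSingularities.Theses.EquisingularLift

/-!
# Disproof attempts for the crux `EquisingularLift` (stmt-ResolutionOfSingularities-15660) — findings

Standing disprover, gen 1 / cycle 1 (2026-08-17). Verdict of this cycle: **no kill; the crux as TYPED is
not refutable by any mechanism presently in print, and is strictly easier than the route's informal
"equisingular lift" thesis.** Everything below is either a kernel-checked lemma or a docstring analysis
(prose only in docstrings/comments, per protocol). Landed companion (Negative lane, `--supports` this item):
`Theorems/EquisingularLift/Negative/FalseWithoutIsIntegral.lean` (p151656) —
`equisingularLift_false_without_isIntegral`.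

## 0. Typing audit (probe `W.lean` rc 0, one sorry)

* `IsBlowup τ C` = Görtz–Wedhorn Def. 13.90 (universal property; `Resolution/Blowups.lean`) — faithful, and
  blow-ups EXIST mathematically for every quasi-coherent ideal, so non-trivial chains are available to a
  prover in principle (the tree has the affine construction `AffineBlowup*.lean`; the global `Proj ⨁ Iᵈ`
  and GW 13.92 are not yet in the tree — a prover-side gap, not a refutation).
* `AlgebraicGeometry.Smooth` (Mathlib: locally standard smooth), `IsProper`, `IsDiscreteValuationRing`,
  `CharZero O`, `vanishingIdeal Y).subscheme` (= reduced induced closed subscheme, Mathlib) — faithful.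
* The `∀ Q …` clause is the induction principle of the chain inductive (planner probe `chain_iff`); the
  trivial chain `(P, 𝟙, Y)` always satisfies it (`inChain_id` below), so ALL content sits in the last two
  conjuncts (irreducible special fibre of `P'`; regular reduced strict transform).
* Residue field: `Y_red ≅ H` with `H` a non-empty `k`-scheme forces every point of `Y` to have residue
  characteristic `p`, hence `Y ⊆ q⁻¹{closed point}` AUTOMATICALLY (a DVR of characteristic 0 has exactly
  the primes `0`, `𝔪`, and `p ∉ 0`): conjunct 3 of the conclusion is implied by conjunct 4 (information
  for the prover: nothing to prove there beyond bookkeeping). Also `Γ(H, 𝒪) = k` forces the residue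
  field of `O` to be (isomorphic to) `k` — `O` is a mixed-characteristic `(0, p)` DVR with algebraically
  closed residue field, e.g. `W(k)` or a finite totally ramified extension of it.

## 1. What the typed statement really says (char-`p` reformulation) — WHY COLLISION ARGUMENTS DO NOT BITE

Let `(O, P, q, Y)` be as in the conclusion, WLOG `P` connected (other components can only be deleted by
blowing up a whole component, which is legal — `C.subscheme = that component` is regular and its image
avoids `ξ` — but useless). Then `P` is integral, every `X'` in the chain is integral (blow-ups of integral
schemes in nowhere-dense centres), and:

* **Irreducibility ⟺ horizontality.** For a regular centre `C ⊆ X'` (regular immersion in the regular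
  `X'`), the exceptional divisor is the projective bundle `ℙ(N_{C/X'}) → C`; a connected component `Cᵢ`
  of `C` contributes a NEW irreducible component to the special fibre iff `Cᵢ` is vertical (contained in
  `X'_s`) and not a Cartier divisor (blowing up a Cartier divisor is an isomorphism, `IsBlowup.isIso`);
  a horizontal (= `O`-flat, since `O` is a DVR) `Cᵢ` has `dim (Eᵢ)_s = dim X'_s - 1`, nowhere dense.
  The strict transform of `P_s` survives to the end (its generic point lies over the open `V ∋ ξ` where
  `σ` is an isomorphism, cf. the invariant proved inside `closes`). Hence
  `IsIrreducible (P'_s)  ⟺  P_s irreducible ∧ every centre component is O-flat or a vertical divisor (no-op)`.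
* **No lift of `H` is ever required.** `Y` lives in the special fibre; it has no generic fibre; the
  characteristic-0 data are only the generic fibres `(Cᵢ)_η` of the centres, which are ARBITRARY regular
  closed subschemes of `P_η` and its successive blow-ups. The effect on the special fibre of blowing up a
  horizontal regular `C` is the blow-up of `X'_s` along the scheme-theoretic fibre `C_s` (Stacks 080C:
  strict transform of `{π = 0}` = `Bl_{C_s} X'_s`; set-theoretically `X''_s = Bl_{C_s}(X'_s) ∪ E_s` with
  `E_s` nowhere dense). `C_s` may be non-reduced (`C = Spec O[t]/(tᵉ − π)` gives the curvilinear fat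
  point `Spec k[t]/tᵉ`): weighted-type centres are PRODUCED, as the card `ramified-coalescence-weights`
  says, and e.g. ONE blow-up of `𝔸²_k` along `(y, x²¹)` resolves the `A₄₂` cusp `y² = x⁴³`.
* **Sandwich.** (lower) `EquisingularLift p ⟹` resolution of every integral hypersurface over every
  algebraically closed field of characteristic `p` (this is the content of `closes`); (upper)
  `EquisingularLift p ⟸` embedded resolution of hypersurfaces `H ⊆ W₀` (any smooth proper `W₀ ⊇ H` that
  lifts to `O`) by blow-ups in regular centres `Dᵢ ⊆ Wᵢ` each of which is the special fibre of a regular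
  `O`-flat `Cᵢ` in the lifted ambient `W̃ᵢ` (then `W̃ᵢ₊₁ := Bl_{Cᵢ} W̃ᵢ`). Closed points ALWAYS lift
  (Hensel: `P(O) → P(k)` is onto for `P` smooth over a complete DVR), and blowing up a section keeps the
  ambient smooth over `O` with special fibre the point blow-up. CONSEQUENCES:
  - `n = 2` (plane curves): EL_p ⟸ classical embedded resolution of plane curves by finitely many
    closed-point blow-ups — a THEOREM in this typing, by successive SECTION blow-ups; no equisingular lift,
    no Ishii2025, no Campillo1980 needed. In particular Kollár 2026 (arXiv:2603.04211, Remark 7: the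
    rational octic `C₈ ⊆ ℙ²_{𝔽₂}` with one `A₄₂` cusp; a reduced complex octic has at most `A₃₇`
    (Gusein-Zade–Nekhoroshev), so NO characteristic-0 plane octic is equisingular to it and the standard
    blow-up sequence has no discrepancy-preserving lift) REFUTES THE INFORMAL MECHANISM of the route
    ("lift H equisingularly and specialise the canonical char-0 centres") already for plane curves of
    degree 8 in characteristic 2 — but NOT the typed crux, whose centres are free.
  - `n = 3` (surfaces): embedded resolution (Abhyankar; Cossart–Jannsen–Saito) uses point AND regular-curve
    centres; a smooth proper curve `D ⊆ Wᵢ,ₛ` lifts formally to `W̃ᵢ` iff an obstruction in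
    `H¹(D, N_{D/Wᵢ,ₛ})` vanishes at every order (then algebraises, Grothendieck existence). This CAN be
    non-zero, but the prover chooses the strategy (curves inside exceptional `ℙ²`'s lift trivially;
    Veronese re-embedding `P = ℙᴺ_O` kills `H¹(D, N_{D/ℙᴺ})` for `deg 𝒪_D(1) > 2g − 2` by the Euler
    sequence). No theorem either way is known to us for `n = 3` in this typing; `n ≥ 5` (dim H ≥ 4) is at
    least as hard as the open resolution problem (lower bound).
* **What a refutation would need.** ONE hypersurface `H/𝔽̄_p` such that for EVERY smooth proper `O`-model
  `P ⊇ H` (any `O`) NO finite sequence of `O`-liftable regular centres resolves `H` inside `P_s`. No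
  invariant obstructing all strategies is in print (Kollár2026 / kangaroo / Moh obstruct specific canonical
  or valuative sequences only). Barrier catalogue (`Literature/Barriers/ResolutionOfSingularities/`):
  Narasimhan (no maximal contact), Hauser kangaroo, Moh bound, InseparableBaseChange, DimensionFourFrontier
  — none yields a `¬` here; they constrain ALGORITHMS, while the crux is a bare existence statement.

## 2. Load-bearing hypotheses (protocol (a))

* `IsIntegral H` — LOAD-BEARING (reducedness half): LANDED `equisingularLift_false_without_isIntegral`
  (double point `Spec k[y]/(y²) ↪ ℙ¹`, closed immersion, locally principal ideal; `Y_red` is reduced).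
  Irreducibility half: NOT load-bearing as far as we can see (two lines meeting in a point: blow up a
  section through the point).
* `IsClosedImmersion ι` — load-bearing (witness `𝔸¹ ↪ ℙ¹` open, kernel `⊥` locally principal, but a
  closed subscheme of the proper `P` cannot be `≅ 𝔸¹`); not formalised (needs "affine + universally
  closed ⇒ finite" bookkeeping), recorded only.
* locally principal ideal — dropping it gives EL for all integral projective varieties, implied by the
  same upper bound (embedded resolution with liftable centres); not refutable.
* `IsAlgClosed k`, `CharP k p`, `p.Prime` — not refutable by us when dropped (points with inseparable
  residue field still lift to `Spec O[T]/(T^p − t̃)`, a DVR); `CharZero O` dropped makes the statement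
  WEAKER (equal characteristic `O = k[[t]]`, constant families) — then it is exactly char-`p` embedded
  resolution with regular centres.

## 3. Natural strengthenings (protocol (c)) — status

* "no blow-up needed" (`P' = P`): FALSE as soon as a singular hypersurface exists (cuspidal cubic); a
  Lean proof needs a projective singular witness with all three hypotheses — near-miss `not_noBlowup`
  below (sorry; obstruction: ~400 lines of chart bookkeeping: `k[y₀,y₁]/(y₀² − y₁³) ≅ k[t², t³]`
  (tree `CuspAlgebra.not_isRegularRing`), primality of `x₁²x₀ − x₂³`, three chart ideals).
* "`Y` = whole special fibre": false for singular `H` (then `H` smooth) — same witness needed.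
* "`O` unramified (`W(k)`)" / "`P = ℙⁿ_O`, `Y = H`" / "all centres `O`-smooth": plausible TRUE, not
  attackable.

## 4. Targets
None this cycle (`payload.stuck_stubs = []`, no line picked).
-/

noncomputable section

set_option linter.dupNamespace false -- mandated namespace of this single-conjunct summit

open CategoryTheory AlgebraicGeometry TopologicalSpace
open Literature.AlgebraicGeometry.Resolution

namespace Summit.ResolutionOfSingularities.ResolutionOfSingularities.Cruxes.EquisingularLift.Disproof

universe u

/-- The chain clause of the crux, isolated: `(P', σ, S')` lies in every class of triples containing
`(P, 𝟙, Y)` and closed under one more blow-up in a regular centre whose image avoids the generic points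
of `Y`. [folklore] -/
def InChain (P : Scheme.{0}) (Y : Set P) (P' : Scheme.{0}) (σ : P' ⟶ P) (S' : Set P') : Prop :=
  ∀ Q : (∀ X' : Scheme.{0}, (X' ⟶ P) → Set X' → Prop), Q P (𝟙 P) Y →
    (∀ (X' X'' : Scheme.{0}) (σ' : X' ⟶ P) (Y' : Set X') (C : X'.IdealSheafData) (τ : X'' ⟶ X'),
      Q X' σ' Y' → IsBlowup τ C → Scheme.IsRegular C.subscheme →
      σ' '' (C.support : Set X') ⊆ {x : P | ¬ IsGenericPoint x Y} →
      Q X'' (τ ≫ σ') (closure (τ ⁻¹' (Y' \ (C.support : Set X'))))) → Q P' σ S'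

/-- VACUITY PROBE: the empty chain is always admissible — the chain clause alone carries no content; a
prover with a REGULAR `H` closes the crux with `P' = P`, and a refuter must attack conjuncts 6–7.
[folklore] -/
theorem inChain_id (P : Scheme.{0}) (Y : Set P) : InChain P Y P (𝟙 P) Y :=
  fun _ h0 _ => h0

/-- One more admissible blow-up keeps a triple in the chain (the successor step of the induction
principle). [folklore] -/
theorem inChain_step {P : Scheme.{0}} {Y : Set P} {X' X'' : Scheme.{0}} {σ' : X' ⟶ P} {Y' : Set X'}
    (h : InChain P Y X' σ' Y') (C : X'.IdealSheafData) (τ : X'' ⟶ X') (hτ : IsBlowup τ C)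
    (hC : Scheme.IsRegular C.subscheme)
    (hT : σ' '' (C.support : Set X') ⊆ {x : P | ¬ IsGenericPoint x Y}) :
    InChain P Y X'' (τ ≫ σ') (closure (τ ⁻¹' (Y' \ (C.support : Set X')))) :=
  fun Q h0 hs => hs X' X'' σ' Y' C τ (h Q h0 hs) hτ hC hT

/-- The crux, restated through `InChain` (definitional unfolding; documents that the `∀ Q` block of the
route decl is literally `InChain P Y P' σ S'`). [folklore] -/
theorem equisingularLift_iff :
    Summit.ResolutionOfSingularities.ResolutionOfSingularities.Theses.EquisingularLift.EquisingularLift ↔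
    ∀ p : ℕ, p.Prime → ∀ (k : Type) [Field k] [CharP k p] [IsAlgClosed k] (n : ℕ) (H : Scheme.{0})
      (ι : H ⟶ (Literature.AlgebraicGeometry.Motives.projectiveSpace n k).left),
      IsClosedImmersion ι → IsIntegral H →
      (∀ y : (Literature.AlgebraicGeometry.Motives.projectiveSpace n k).left,
        ∃ U : (Literature.AlgebraicGeometry.Motives.projectiveSpace n k).left.affineOpens,
          y ∈ (U : (Literature.AlgebraicGeometry.Motives.projectiveSpace n k).left.Opens) ∧
            (ι.ker.ideal U).IsPrincipal) →
      ∃ (O : Type) (_ : CommRing O) (_ : IsDomain O) (_ : IsDiscreteValuationRing O) (_ : CharZero O)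
        (P P' : Scheme.{0}) (q : P ⟶ Spec (.of O)) (Y : Closeds P) (σ : P' ⟶ P) (S' : Set P'),
        Smooth q ∧ IsProper q ∧ (Y : Set P) ⊆ q ⁻¹' {IsLocalRing.closedPoint O} ∧
        Nonempty ((Scheme.IdealSheafData.vanishingIdeal Y).subscheme ≅ H) ∧
        InChain P (Y : Set P) P' σ S' ∧
        IsIrreducible ((σ ≫ q) ⁻¹' {IsLocalRing.closedPoint O}) ∧
        Scheme.IsRegular (Scheme.IdealSheafData.vanishingIdeal
          (⟨closure S', isClosed_closure⟩ : Closeds P')).subscheme :=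
  Iff.rfl

/-- NEAR-MISS (protocol (e)) — the natural strengthening "no blow-up is needed" (`P' = P`, `σ = 𝟙`,
`S' = Y`) is false: it would make every integral hypersurface over `𝔽̄_p` isomorphic to a regular scheme.
Witness intended: the cuspidal cubic `V₊(x₁² x₀ − x₂³) ⊆ ℙ²` over `𝔽₂^alg`, singular at `[1:0:0]`
(chart ring `k[y₀,y₁]/(y₀² − y₁³) ≅ k[t², t³]`, not regular by the tree's
`WildQuotientResolution.Negative.CuspAlgebra.not_isRegularRing`). OBSTRUCTION (bookkeeping only, ~400
lines): integrality of `V₊(F)_red` (primality of `F`), local principality on the three charts, and the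
transport `Scheme.IsRegular Y_red → IsRegularRing (chart ring)`; deferred — its information content for
provers is only "a singular hypersurface satisfies the hypotheses" (non-vacuity), which nobody doubts. -/
theorem not_noBlowup : ¬ (∀ p : ℕ, p.Prime → ∀ (k : Type) [Field k] [CharP k p] [IsAlgClosed k]
    (n : ℕ) (H : Scheme.{0}) (ι : H ⟶ (Literature.AlgebraicGeometry.Motives.projectiveSpace n k).left),
      IsClosedImmersion ι → IsIntegral H →
      (∀ y : (Literature.AlgebraicGeometry.Motives.projectiveSpace n k).left,
        ∃ U : (Literature.AlgebraicGeometry.Motives.projectiveSpace n k).left.affineOpens,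
          y ∈ (U : (Literature.AlgebraicGeometry.Motives.projectiveSpace n k).left.Opens) ∧
            (ι.ker.ideal U).IsPrincipal) →
      ∃ (O : Type) (_ : CommRing O) (_ : IsDomain O) (_ : IsDiscreteValuationRing O) (_ : CharZero O)
        (P : Scheme.{0}) (q : P ⟶ Spec (.of O)) (Y : Closeds P),
        Smooth q ∧ IsProper q ∧ (Y : Set P) ⊆ q ⁻¹' {IsLocalRing.closedPoint O} ∧
        Nonempty ((Scheme.IdealSheafData.vanishingIdeal Y).subscheme ≅ H) ∧
        IsIrreducible (q ⁻¹' {IsLocalRing.closedPoint O}) ∧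
        Scheme.IsRegular (Scheme.IdealSheafData.vanishingIdeal Y).subscheme) := by
  sorry

end Summit.ResolutionOfSingularities.ResolutionOfSingularities.Cruxes.EquisingularLift.Disproof

end
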